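import Literature.NumberTheory.Automorphic.UnitaryGroupInertPlaceHyperbolicBasis
import Literature.NumberTheory.LocalFields.UnramifiedQuadraticNormSurjective
import Mathlib.RingTheory.Invariant.Basic
import Mathlib.FieldTheory.Finite.GaloisField
import HarnessLib

/-!
# Unimodular hermitian lattices at an inert place have a hyperbolic basis — dyadic places included
# (Jacobowitz 1962, Thm. 7.1, with the trace hypothesis supplied by the residue field: Serre, *Local Fields*, V §2)

Topic `NumberTheory/Automorphic`; namespace `Literature.NumberTheory.Automorphic.UnitaryGroup` (lane `lit-hodgefound`,
Track 2 foundations; seat `lit-hodgefound-p11`, generation 33, row g33-#8).  THEOREMS ONLY: no definition, no named fact,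
no instance, no notation.

The sibling `UnitaryGroupInertPlaceHyperbolicBasis.lean` (cell hodgecm-mathlib, piece (2a) `HyperbolicBasis` of
`b4-hyperspecial-gelfand-pair`) proves: at a finite place `v` of `F` UNRAMIFIED and NON-SPLIT in the quadratic extension
`E/F` and NON-DYADIC (`2 ∉ v`), a `w`-unimodular `c`-hermitian `J` has `placeForm J w = (σ_w T)ᵀ · antidiag(1,…,1) · T` for
some `T ∈ GL_N(𝒪_w)`.  The hypothesis `2 ∉ v` enters only through the (trace) hypothesis of the Jacobowitz engine
`HermitianUnimodular.exists_formCongr_eq` (`b = ½`).  This file removes it: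

* §1 **`exists_smul_sub_notMem`** — at an unramified non-split place, `c` acts NON-TRIVIALLY on the residue field
  `𝓞_E/𝔓_w`: some `a ∈ 𝓞_E` has `c a − a ∉ 𝔓_w`.  (The decomposition group of `𝔓_w` is all of `Gal(E/F) = {1, c}`
  and surjects onto `Aut(k_w/k_v)` — Mathlib `Ideal.Quotient.stabilizerHom_surjective`; `[k_w : k_v] = f(w|v) = 2`
  because `e f g = 2` with `e = g = 1` (`inertiaDeg_eq_two_of_finitePlacesOver_eq_singleton`); a quadratic extension of
  finite fields has a non-trivial automorphism (`IsGalois.card_aut_eq_finrank`).) [Serre1979, Ch. I §7 Prop. 20–21;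
  Ch. V §2]
* §2 **`exists_add_map_eq_one_integer`** — hence (trace) holds in `𝒪_w = 𝒪[E_w]` at EVERY unramified non-split place:
  `b + σ_w b = 1` for some `b ∈ 𝒪_w`, for any involutive endomorphism of `𝒪_w` agreeing with `σ_w` (`σ_w a − a` is a `w`-unit;
  `HermitianFormsHensel.exists_add_map_eq_one_of_isUnit_sub`).
* §3 **`exists_glInt_placeForm_eq_formCongr_antidiagonal_of_isUnramifiedIn`** — piece (2a) WITHOUT `2 ∉ v`: at every
  finite place unramified and non-split in `E/F` (dyadic or not), a `w`-unimodular `c`-hermitian `J` has a hyperbolic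
  `𝒪_w`-basis, `placeForm J w = (σ_w T)ᵀ · antidiag(1, …, 1) · T` with `T ∈ GL_N(𝒪_w)` — [Jacobowitz1962, §7 Thm. 7.1]
  covers the unramified dyadic case («unramified» there includes `p = 2`).  Proof = the sibling's, with (trace) from §2 and
  (norm) from the sibling's `exists_mul_galAdicCompletionMap_eq_of_isUnramifiedIn` (O'Meara 63:16, all residue
  characteristics).

## References
* [Jacobowitz1962] R. Jacobowitz, *Hermitian forms over local fields*, Amer. J. Math. 84 (1962), §7 Thm. 7.1 (unramified,
  including dyadic).
* [Serre1979] J.-P. Serre, *Local Fields*, Ch. I §7 (decomposition and inertia groups, Prop. 20–21: `D/I ≅ Gal(k_w/k_v)`),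
  Ch. V §2 (trace in unramified extensions).
* [Omeara1963] O. T. O'Meara, *Introduction to quadratic forms*, §63C Example 63:16.
* [CasselsFrohlichANT1967] J. W. S. Cassels, A. Fröhlich (eds.), *Algebraic Number Theory* (1967), Ch. VII §1.1 and
  Prop. 1.2 (ii) (one place above a non-split `v`).
-/

set_option autoImplicit false

noncomputable section

open NumberField IsDedekindDomain
open scoped Matrix ValuativeRel Pointwise

namespace Literature.NumberTheory.Automorphic.UnitaryGroup

open Literature.NumberTheory.Automorphic Literature.NumberTheory.QuadraticForms

variable {F E : Type} [Field F] [NumberField F] [Field E] [NumberField E] [Algebra F E]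
  [Algebra.IsQuadraticExtension F E] (c : E ≃ₐ[F] E) {v : HeightOneSpectrum (𝓞 F)} (w : PlacesOver E v)

/-! ## §1 At an unramified non-split place the Galois involution is non-trivial on the residue field -/

/-- At a non-split place (`c • w = w`, `c ≠ 1`) `w` is the only place of `E` above `v`.
[cite: CasselsFrohlichANT1967, Ch. VII Prop. 1.2 (ii)] -/
theorem finitePlacesOver_eq_singleton_of_smul_eq (hc : c ≠ 1) (hw : c • w.1 = w.1) :
    finitePlacesOver E v = {w.1} := by
  haveI : Subsingleton (PlacesOver E v) := PlacesOver.subsingleton_of_smul_eq c hc w hw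
  refine Set.eq_singleton_iff_unique_mem.2 ⟨w.2, fun w' hw' => ?_⟩
  exact congrArg Subtype.val (Subsingleton.elim (⟨w', hw'⟩ : PlacesOver E v) w)

/-- **The Galois involution acts non-trivially on the residue field at an unramified inert place**: if `v` is unramified in
`E`, `c ≠ 1` and `c • w = w`, then `c a − a ∉ 𝔓_w` for some `a ∈ 𝓞_E`.  (Decomposition group `= {1, c}` surjects onto
`Aut(k_w/k_v)` — `Ideal.Quotient.stabilizerHom_surjective`; `[k_w : k_v] = f(w|v) = 2`; a degree-`2` extension of finite
fields has `2` automorphisms.) [cite: Serre1979, Ch. I §7 Prop. 20 and Cor.; Ch. V §2] -/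
theorem exists_smul_sub_notMem (hc : c ≠ 1) (hw : c • w.1 = w.1) (hv : Algebra.IsUnramifiedIn (𝓞 E) v.asIdeal) :
    ∃ a : 𝓞 E, c • a - a ∉ w.1.asIdeal := by
  classical
  haveI : IsGaloisGroup (E ≃ₐ[F] E) (𝓞 F) (𝓞 E) := IsGaloisGroup.of_isFractionRing _ _ _ F E
  haveI : v.asIdeal.IsMaximal := v.isMaximal
  haveI : w.1.asIdeal.IsMaximal := w.1.isMaximal
  have hvw : v.asIdeal = (w.1.asIdeal).under (𝓞 F) := by rw [← HeightOneSpectrum.under_asIdeal, w.2]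
  haveI hlies : w.1.asIdeal.LiesOver v.asIdeal := ⟨hvw⟩
  -- residue degree `2`
  have hf : w.1.asIdeal.inertiaDeg (𝓞 F) = 2 :=
    inertiaDeg_eq_two_of_finitePlacesOver_eq_singleton hv (finitePlacesOver_eq_singleton_of_smul_eq c w hc hw)
  letI : Field (𝓞 F ⧸ v.asIdeal) := Ideal.Quotient.field v.asIdeal
  letI : Field (𝓞 E ⧸ w.1.asIdeal) := Ideal.Quotient.field w.1.asIdeal
  haveI : Finite (𝓞 E ⧸ w.1.asIdeal) := Ideal.finiteQuotientOfFreeOfNeBot w.1.asIdeal w.1.ne_bot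
  have hfin : Module.finrank (𝓞 F ⧸ v.asIdeal) (𝓞 E ⧸ w.1.asIdeal) = 2 := by
    rw [← Ideal.inertiaDeg_eq_of_isMaximal v.asIdeal w.1.asIdeal, hf]
  haveI : FiniteDimensional (𝓞 F ⧸ v.asIdeal) (𝓞 E ⧸ w.1.asIdeal) := Module.finite_of_finrank_eq_succ hfin
  -- a non-trivial automorphism of the residue extension
  have hcard : Nat.card ((𝓞 E ⧸ w.1.asIdeal) ≃ₐ[𝓞 F ⧸ v.asIdeal] (𝓞 E ⧸ w.1.asIdeal)) = 2 := by
    rw [IsGalois.card_aut_eq_finrank, hfin]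
  obtain ⟨f, hf1⟩ : ∃ f : (𝓞 E ⧸ w.1.asIdeal) ≃ₐ[𝓞 F ⧸ v.asIdeal] (𝓞 E ⧸ w.1.asIdeal), f ≠ 1 := by
    by_contra h
    push Not at h
    have hsub : Subsingleton ((𝓞 E ⧸ w.1.asIdeal) ≃ₐ[𝓞 F ⧸ v.asIdeal] (𝓞 E ⧸ w.1.asIdeal)) :=
      ⟨fun a b => by rw [h a, h b]⟩
    have h1 := Finite.card_le_one_iff_subsingleton.mpr hsub
    omega
  -- lift it to the decomposition group `{1, c}`
  have hstab : c ∈ MulAction.stabilizer (E ≃ₐ[F] E) w.1.asIdeal := by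
    rw [MulAction.mem_stabilizer_iff, ← HeightOneSpectrum.smul_asIdeal, hw]
  obtain ⟨g, hg⟩ := Ideal.Quotient.stabilizerHom_surjective (E ≃ₐ[F] E) v.asIdeal w.1.asIdeal f
  have hg1 : (g : E ≃ₐ[F] E) ≠ 1 := by
    intro h1
    apply hf1
    rw [← hg]
    have : g = 1 := Subtype.ext h1
    rw [this, map_one]
  have hgc : (g : E ≃ₐ[F] E) = c :=
    (Literature.NumberTheory.Automorphic.algEquiv_eq_one_or_eq (F := F) hc (g : E ≃ₐ[F] E)).resolve_left hg1
  -- `f ≠ 1`: some residue class is moved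
  obtain ⟨x, hx⟩ : ∃ x : 𝓞 E ⧸ w.1.asIdeal, f x ≠ x := by
    by_contra h
    push Not at h
    exact hf1 (AlgEquiv.ext h)
  obtain ⟨a, rfl⟩ := Ideal.Quotient.mk_surjective x
  refine ⟨a, fun hmem => hx ?_⟩
  rw [← hg, Ideal.Quotient.stabilizerHom_apply]
  change Ideal.Quotient.mk w.1.asIdeal ((g : E ≃ₐ[F] E) • a) = Ideal.Quotient.mk w.1.asIdeal a
  rw [Ideal.Quotient.eq, hgc]
  exact hmem

/-! ## §2 (trace) in `𝒪_w` at every unramified non-split place -/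

/-- **The trace `𝒪_w → 𝒪_v` hits `1` at an unramified non-split place, dyadic or not**: for every ring endomorphism `σO`
of the valuation ring `𝒪_w = 𝒪[E_w]` that agrees with `σ_w = galAdicCompletionMap c` (in practice its restriction) and is
an involution, some `b ∈ 𝒪_w` has `b + σO b = 1` — from §1 (`σ_w a − a` is a `w`-adic unit for a global `a ∈ 𝓞_E` moved by
`c` modulo `𝔓_w`) and `HermitianFormsHensel.exists_add_map_eq_one_of_isUnit_sub`.
[cite: Serre1979, Ch. V §2 Prop. 3 (proof: «the trace is surjective in every separable extension»)] -/
theorem exists_add_map_eq_one_integer (hc : c ≠ 1) (hw : c • w.1 = w.1)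
    (hv : Algebra.IsUnramifiedIn (𝓞 E) v.asIdeal)
    (σO : 𝒪[w.1.adicCompletion E] →+* 𝒪[w.1.adicCompletion E])
    (hσO : ∀ x : 𝒪[w.1.adicCompletion E], ((σO x : 𝒪[w.1.adicCompletion E]) : w.1.adicCompletion E) =
      galAdicCompletionMap (L := E) c hw x)
    (hσσ : ∀ x, σO (σO x) = x) :
    ∃ b : 𝒪[w.1.adicCompletion E], b + σO b = 1 := by
  obtain ⟨a, ha⟩ := exists_smul_sub_notMem c w hc hw hv
  -- the global element `a` and its conjugate, seen in `E_w`
  have hcoe : ∀ r : 𝓞 E, algebraMap (𝓞 E) (w.1.adicCompletion E) r = ((r : E) : w.1.adicCompletion E) := fun r => by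
    rw [IsScalarTower.algebraMap_apply (𝓞 E) E (w.1.adicCompletion E), HeightOneSpectrum.algebraMap_adicCompletion]
    rfl
  have hamem : ((a : E) : w.1.adicCompletion E) ∈ 𝒪[w.1.adicCompletion E] := by
    rw [mem_integer_iff_mem_adicCompletionIntegers]
    exact HeightOneSpectrum.coe_mem_adicCompletionIntegers w.1 a
  set xa : 𝒪[w.1.adicCompletion E] := ⟨((a : E) : w.1.adicCompletion E), hamem⟩ with hxa_def
  -- `σ_w a − a` is the image of `c • a − a ∉ 𝔓_w`, a `w`-adic unit
  have hdiff : ((σO xa - xa : 𝒪[w.1.adicCompletion E]) : w.1.adicCompletion E) =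
      algebraMap (𝓞 E) (w.1.adicCompletion E) (c • a - a) := by
    rw [map_sub, hcoe, hcoe, RingOfIntegers.coe_algEquiv_smul, ← galAdicCompletionMap_coe_algEquiv (σ := c) (h := hw)]
    change ((σO xa : 𝒪[w.1.adicCompletion E]) : w.1.adicCompletion E) - (xa : w.1.adicCompletion E) = _
    rw [hσO]
  have hv1 : Valued.v (((σO xa - xa : 𝒪[w.1.adicCompletion E]) : w.1.adicCompletion E)) = 1 := by
    rw [hdiff]
    exact valued_algebraMap_eq_one (K := E) (v := w.1) ha
  have hne : (((σO xa - xa : 𝒪[w.1.adicCompletion E]) : w.1.adicCompletion E)) ≠ 0 := by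
    intro h0
    rw [h0, map_zero] at hv1
    exact zero_ne_one hv1
  have hv1' : ValuativeRel.valuation (w.1.adicCompletion E)
      (((σO xa - xa : 𝒪[w.1.adicCompletion E]) : w.1.adicCompletion E)) = 1 := by
    rwa [(ValuativeRel.isEquiv (ValuativeRel.valuation (w.1.adicCompletion E))
      (Valued.v : Valuation (w.1.adicCompletion E) _)).eq_one_iff_eq_one]
  have hunit : IsUnit (σO xa - xa) :=
    Valuation.Integers.isUnit_of_one (Valuation.integer.integers _) (isUnit_iff_ne_zero.2 hne) hv1'
  exact Literature.LinearAlgebra.Matrix.HermitianFormsHensel.exists_add_map_eq_one_of_isUnit_sub σO hσσ hunit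

/-! ## §3 Piece (2a) at every unramified non-split place, dyadic places included -/

/-- **Unimodular hermitian lattices at an unramified inert place have a hyperbolic basis — no condition on the residue
characteristic** ([Jacobowitz1962, §7 Thm. 7.1], unramified case including dyadic): at a place `v` of `F` UNRAMIFIED and
NON-SPLIT in the quadratic extension `E` (`c • w = w`), a `c`-hermitian `J ∈ M_N(E)` that is `w`-unimodular
(`placeForm J w ∈ GL_N(𝒪_w)`) admits `T ∈ GL_N(𝒪_w)` with `placeForm J w = (σ_w T)ᵀ · antidiag(1, …, 1) · T`.  The sibling
`exists_glInt_placeForm_eq_formCongr_antidiagonal` assumes in addition `2 ∉ v`; here (trace) comes from §2 instead of `½`,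
(norm) from `exists_mul_galAdicCompletionMap_eq_of_isUnramifiedIn` as there, and the algebra is
`HermitianUnimodular.exists_formCongr_eq`. [cite: Jacobowitz1962, §7 Thm. 7.1] -/
theorem exists_glInt_placeForm_eq_formCongr_antidiagonal_of_isUnramifiedIn (F E : Type) [Field F] [NumberField F]
    [Field E] [NumberField E] [Algebra F E] [Algebra.IsQuadraticExtension F E] (c : E ≃ₐ[F] E) (hc1 : c ≠ 1) (N : ℕ)
    (J : Matrix (Fin N) (Fin N) E) (hJh : (J.map c)ᵀ = J)
    (v : HeightOneSpectrum (𝓞 F)) (w : PlacesOver E v) (hw : c • w.1 = w.1)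
    (hv : Algebra.IsUnramifiedIn (𝓞 E) v.asIdeal)
    (hJw : IsUnit (placeForm J w.1)) (hJi : hJw.unit ∈ glInt N (w.1.adicCompletion E)) :
    ∃ T : GL (Fin N) (w.1.adicCompletion E), T ∈ glInt N (w.1.adicCompletion E) ∧
      placeForm J w.1 =
        formCongr (galAdicCompletionMap (L := E) c hw) T ((StdForm.antidiagonal N).over (w.1.adicCompletion E)) := by
  haveI : CharZero (w.1.adicCompletion E) := charZero_of_injective_algebraMap (algebraMap E _).injective
  -- the involution `σ_w` restricted to the valuation ring `𝒪 = 𝒪[E_w]`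
  have hmem : ∀ x ∈ 𝒪[w.1.adicCompletion E], galAdicCompletionMap (L := E) c hw x ∈ 𝒪[w.1.adicCompletion E] :=
    fun x hx => galAdicCompletionMap_mem_integer c w hw hx
  let σO : 𝒪[w.1.adicCompletion E] →+* 𝒪[w.1.adicCompletion E] :=
    (galAdicCompletionMap (L := E) c hw).restrict 𝒪[w.1.adicCompletion E] 𝒪[w.1.adicCompletion E] hmem
  have hσO : ∀ x : 𝒪[w.1.adicCompletion E], ((σO x : 𝒪[w.1.adicCompletion E]) : w.1.adicCompletion E) =
      galAdicCompletionMap (L := E) c hw x := fun _ => rfl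
  have hσσ : ∀ x, σO (σO x) = x := fun x =>
    Subtype.ext (galAdicCompletionMap_galAdicCompletionMap_of_smul_eq c w hc1 hw x)
  -- (trace): from the residue field (§2), no condition on `2`
  have htr : ∃ b : 𝒪[w.1.adicCompletion E], b + σO b = 1 := exists_add_map_eq_one_integer c w hc1 hw hv σO hσO hσσ
  -- (norm): `σ_w`-fixed units of `𝒪` are norms `t σ_w(t)`
  have hnorm : ∀ u : 𝒪[w.1.adicCompletion E], IsUnit u → σO u = u → ∃ t : 𝒪[w.1.adicCompletion E], t * σO t = u := by
    intro u hu hσu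
    have hu1 : Valued.v (u : w.1.adicCompletion E) = 1 := by
      rw [← (ValuativeRel.isEquiv (ValuativeRel.valuation (w.1.adicCompletion E))
        (Valued.v : Valuation (w.1.adicCompletion E) _)).eq_one_iff_eq_one]
      exact Valuation.Integers.one_of_isUnit (Valuation.integer.integers _) hu
    have hfix : galAdicCompletionMap (L := E) c hw u = u := by rw [← hσO, hσu]
    obtain ⟨t, ht1, htt⟩ := exists_mul_galAdicCompletionMap_eq_of_isUnramifiedIn c w hc1 hw hv u hu1 hfix
    have htmem : t ∈ 𝒪[w.1.adicCompletion E] := by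
      rw [mem_integer_iff_mem_adicCompletionIntegers, HeightOneSpectrum.mem_adicCompletionIntegers, ht1]
    exact ⟨⟨t, htmem⟩, Subtype.ext htt⟩
  -- pull the two forms back to `GL_N(𝒪)`
  obtain ⟨H₀, hH₀⟩ := hJi
  have hH₀val : (H₀ : Matrix (Fin N) (Fin N) 𝒪[w.1.adicCompletion E]).map (𝒪[w.1.adicCompletion E]).subtype = placeForm J w.1 := by
    have h := congrArg (fun g : GL (Fin N) (w.1.adicCompletion E) => (g : Matrix (Fin N) (Fin N) (w.1.adicCompletion E))) hH₀
    rw [IsUnit.unit_spec] at h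
    exact h
  have hinj : Function.Injective fun M : Matrix (Fin N) (Fin N) 𝒪[w.1.adicCompletion E] =>
      M.map (𝒪[w.1.adicCompletion E]).subtype := Matrix.map_injective Subtype.val_injective
  have hcomm : (⇑(𝒪[w.1.adicCompletion E]).subtype ∘ ⇑σO) = ⇑(galAdicCompletionMap (L := E) c hw) ∘ ⇑(𝒪[w.1.adicCompletion E]).subtype :=
    funext fun x => hσO x
  have hH₀h : ((H₀ : Matrix (Fin N) (Fin N) 𝒪[w.1.adicCompletion E]).map σO)ᵀ = H₀ := by
    apply hinj
    change (((Units.val H₀).map σO)ᵀ).map _ = (Units.val H₀).map _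
    rw [Matrix.transpose_map, Matrix.map_map, hcomm, ← Matrix.map_map, hH₀val]
    exact placeForm_hermitian_of_smul_eq c w J hJh hw
  have hH₀det : IsUnit (Units.val H₀).det := by
    rw [← Matrix.isUnit_iff_isUnit_det]
    exact Units.isUnit H₀
  have hJ₀h : (((StdForm.antidiagonal N).over 𝒪[w.1.adicCompletion E]).map σO)ᵀ = (StdForm.antidiagonal N).over 𝒪[w.1.adicCompletion E] := by
    rw [StdForm.over_map, StdForm.transpose_over]
  have hJ₀det : IsUnit ((StdForm.antidiagonal N).over 𝒪[w.1.adicCompletion E]).det :=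
    (Matrix.isUnit_iff_isUnit_det _).1 (StdForm.isUnit_over _ _)
  -- Jacobowitz over the local ring `𝒪`
  obtain ⟨T₀, hT₀⟩ := HermitianUnimodular.exists_formCongr_eq σO hσσ htr hnorm
    (H₀ : Matrix (Fin N) (Fin N) 𝒪[w.1.adicCompletion E]) ((StdForm.antidiagonal N).over 𝒪[w.1.adicCompletion E])
    hH₀h hH₀det hJ₀h hJ₀det
  refine ⟨Matrix.GeneralLinearGroup.map (𝒪[w.1.adicCompletion E]).subtype T₀, ⟨T₀, rfl⟩, ?_⟩
  -- push the congruence forward along `𝒪 ↪ E_w`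
  have h := congrArg (fun M : Matrix (Fin N) (Fin N) 𝒪[w.1.adicCompletion E] => M.map (𝒪[w.1.adicCompletion E]).subtype) hT₀
  simp only [formCongr, Matrix.map_mul, Matrix.transpose_map, Matrix.map_map, hcomm, StdForm.over_map, hH₀val] at h
  rw [← h]
  rfl

end Literature.NumberTheory.Automorphic.UnitaryGroup

end
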